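import Literature.AlgebraicGeometry.HodgeTheory.CMHodgeGroupTwoMixedPlacesKWeil
import HarnessLib

/-!
# `Lie Hg ⊗ ℂ ⊇ 𝔲_E ∩ 𝔰𝔲_K` for `E = ℚ[φ]` COMMUTATIVE of degree `4` (a CM field OR `K × K`) acting with multiplicity `3`,
# both places MIXED, of `K`-Weil type along the CM type — the division hypothesis of R11-5 is redundant
# (TABLE X row 11 `(2,1)+(1,2)` AND row 19 `Y₃ × Y₃′`; Moonen–Zarhin 1998 §4, 1999 (2.3), (5.11); Ribet 1983 §3)

Family `hodge`, layer `Literature/AlgebraicGeometry/HodgeTheory` (cell `pub-hodgeav-hg6`, req-37 (A) Q2b; eng-4 g9, brick T3b (A);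
lead g4 2026-08-29). UNCONDITIONAL; theorems only, no definition, no named fact, no `sorry`. HONEST FRAMING of that cell:
HC / HC_AV / HC_CM / H2 NOT proved — linear algebra of polarized weight-one `ℚ`-Hodge structures.

WHAT THIS FILE DOES. It GENERALISES R11-5's `CMThetaKWeil.…_twoMixed` theorems by deleting the division hypothesis; the proofs
are transplanted with a one-line swap (documented generalisation, not a restatement). In detail: the row-11 brick `CMHodgeGroupTwoMixedPlacesKWeil` (R11-5) proves the LIFT property and the
`SU_K`-socket for `E = End_Hdg(V) = ℚ[φ]` of dimension `2|ι|`, `ι = {k₁, k₂}`, two `3`-blocks `W_{μ k}` BOTH MIXED, a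
`ψ`-skew `y ∈ E` acting by one scalar `ν ≠ 0` on the CM type, balance `(p₁ − q₁) + (p₂ − q₂) = 0`, under the additional
hypothesis `hdiv` that every non-zero element of `E` is invertible (`E` a FIELD; for an abelian variety: `A` simple). That
hypothesis is used at exactly one point — `CMNoTwist3.proj_of_exists_mixed`, which transports «`𝔡_ℂ` induces `𝔰𝔩(W_{μ k})`»
from ONE mixed place to every place through the equidimensionality lemma `CMPlaces.forall_proj_of_proj` (genuinely a
statement about a field). With BOTH places mixed the transport is unnecessary: the tree's `CMNoTwist3.proj_of_mixed`
(division-free: an irreducible mixed `3`-block with `Θ ∈ 𝔤_ℂ` has `𝔡_ℂ|_W ⊇ 𝔰𝔩(W)`) applies at each place. This file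
re-runs R11-5 §4–§5 with that one-line change and the binders `hdiv` and (then idle) `hEdim` STRUCK; every other input
(`CMIrred.eigenspace_irreducible`, `CMTheta.exists_adaptedDualBasis`, R11-4 `CMThetaKWeil.not_exists_intertwiner_conj_of_traceOrthogonal`,
R11-5 §1–§3, R11-2 `CMThetaKWeil.trace_mul_eq_zero_of_mem_hodgeLie`, the socket `CMThetaSocket.mem_spanC_of_lift_of_trace_add_eq_zero`)
was already division-free.

WHY. For TABLE X row 19 (`A ∼ Y₃ × Y₃′`, `Y ≄ Y′` simple type-IV threefolds with `End⁰ = K`, the diagonal `K` of Weil type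
`(3,3)`, signatures `(2,1)` / `(1,2)`) the Hodge structure `H¹(A)` has `End_Hdg = K × K = ℚ[φ_E]` — commutative of dimension
`4 = 2|ι|`, single-generated (four eigenvalues), NOT a field — with the two `3`-blocks `W_K(Y)`, `W_K(Y′)` both mixed and of
`K`-signature `3`: every hypothesis below, verbatim. So rows 11 and 19 share ONE Lie theorem (Moonen–Zarhin 1999 (5.11)
Case 1: «the same argument as in (2.3)»).

* §4 `CMThetaKWeil.lift_at_of_twoMixed_kWeil_noDiv`, `CMThetaKWeil.lift_of_twoMixed_kWeil_noDiv` — the LIFT property;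
* §5 **`CMThetaKWeil.mem_spanC_of_commute_of_skew_of_trace_twoMixed_noDiv`** (admissible `𝔤`) and
  **`CMThetaKWeil.mem_hodgeLieC_of_commute_of_skew_of_trace_twoMixed_noDiv`** (`𝔤 = Lie Hg`, UNCONDITIONAL): every
  `φ_ℂ`-commuting `ψ_ℂ`-skew `Y` with `tr(Y|_{W_{μk₁}}) + tr(Y|_{W_{μk₂}}) = 0` lies in `𝔤_ℂ` — the statements of R11-5 §4–§5
  VERBATIM minus `hdiv`, `hEdim`.

## References
* [MoonenZarhin1998WeilClasses] B. Moonen, Yu. Zarhin, J. reine angew. Math. 496 (1998), §4 Remark (1).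
* [MoonenZarhin1999LowDim] B. Moonen, Yu. Zarhin, Math. Ann. 315 (1999), §2 (2.3), §3 (3.1), §5 (5.11) Case 1.
* [Ribet1983] K. A. Ribet, Amer. J. Math. 105 (1983), §3 (Lie algebra lemma), Thm. 0.
* [Ribet1976RealMultiplications] K. A. Ribet, Amer. J. Math. 98 (1976), pp. 790–791.
* [Deligne1982HodgeCycles] P. Deligne, LNM 900 (1982), I §3 Prop. 3.4, §4 (p. 30).
* [GoodmanWallachGTM255] R. Goodman, N. R. Wallach, GTM 255 (2009), §4.1.1.
-/

noncomputable section

open scoped TensorProduct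
open Module Matrix

namespace Literature.AlgebraicGeometry.Motives

namespace HodgeStructure

open Literature.AlgebraicGeometry.HodgeTheory (exists_basis_eigenspace_of_blocks toMatrix_restrict_eq_of_apply_eq_sum')

universe u

variable {V : Type u} [AddCommGroup V] [Module ℚ V] {n : ℤ}

/-- `Fin 2 = {0, 1}`. [folklore] -/
private theorem CMThetaKWeil.fin2_cases_nd (r : Fin 2) : r = 0 ∨ r = 1 := by
  rcases r with ⟨_ | _ | k, hk⟩
  · exact Or.inl rfl
  · exact Or.inr rfl
  · omega

/-! ### §4 The LIFT property for two mixed places of a `K`-Weil CM type -/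

/-- **THE LIFT PROPERTY AT ONE PLACE, TWO MIXED PLACES, `K`-WEIL — DIVISION-FREE** (R11-5's `lift_at_of_twoMixed_kWeil` minus `hdiv`, `hEdim`; the projection onto `𝔰𝔩(W_{μ k})` is taken at the mixed place `k` itself by `CMNoTwist3.proj_of_mixed`) (see the module docstring): `ι = {a, b}`, `n₀ = 3`, both
blocks mixed, the `K`-datum `y` (one scalar `ν ≠ 0` on the CM type, `ψ`-skew) with `𝔤` trace-orthogonal to it, and the
balance `(p_a − q_a) + (p_b − q_b) = 0`. Then every traceless endomorphism of `W_{μ a}` is induced by an element of `𝔤_ℂ`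
vanishing on `W_{μ b}`: Ribet's lemma (`LieGoursatTwist.lift_or_twist_of_submodules`, `d = 3`, block bases extracted from an
adapted dual basis) gives LIFT or a twist; a twist of type I is an intertwiner `W_{μ b} ≃ W_{μ a}` and forces
`p_a − q_a = p_b − q_b` (§3), contradicting the balance for `n₀ = 3`; a twist of type II is, after transposition through the
dual basis (§1), an intertwiner `W_{μ̄ b} ≃ W_{μ a}`, excluded by `CMThetaKWeil.not_exists_intertwiner_conj_of_traceOrthogonal`.
[cite: MoonenZarhin1999LowDim, §2 (2.3)] [cite: Ribet1983, §3] [cite: MoonenZarhin1998WeilClasses, §4 Remark (1)]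
[cite: Ribet1976RealMultiplications, pp. 790–791] -/
theorem CMThetaKWeil.lift_at_of_twoMixed_kWeil_noDiv [Module.Finite ℚ V] [HodgeTensorFacts.{u, u}] {ι : Type} [Fintype ι]
    [DecidableEq ι] (H : HodgeStructure V n) (hn : n = 1) (heff : H.IsEffective) (ψ : H.Polarization)
    {φ : Module.End ℚ V} (hφE : φ ∈ H.endAlg) {m : ℕ} (hE : ∀ a ∈ H.endAlg, ∃ q : Fin m → ℚ, a = ∑ k, q k • φ ^ (k : ℕ))
    (μ : ι → ℂ) (hinj : Function.Injective μ) (hdist : ∀ k k', μ k' ≠ starRingEnd ℂ (μ k))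
    (hrank : ∀ k, Module.finrank ℂ ↥(Module.End.eigenspace (φ.baseChange ℂ) (μ k) ⊓ H.piece 1 0) +
      Module.finrank ℂ ↥(Module.End.eigenspace (φ.baseChange ℂ) (μ k) ⊓ H.piece 0 1) = 3)
    (htop : (⨆ kt : ι × Fin 2, Module.End.eigenspace (φ.baseChange ℂ)
      (if kt.2 = 0 then μ kt.1 else starRingEnd ℂ (μ kt.1))) = ⊤)
    {y : Module.End ℚ V} (hyskew : ∀ v w, ψ.form (y v) w + ψ.form v (y w) = 0) {ν : ℂ} (hν : ν ≠ 0)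
    (hyν : ∀ k, ∀ w ∈ Module.End.eigenspace (φ.baseChange ℂ) (μ k), y.baseChange ℂ w = ν • w)
    (𝔤 : Submodule ℚ (Module.End ℚ V)) (hbr : ∀ X ∈ 𝔤, ∀ X' ∈ 𝔤, X * X' - X' * X ∈ 𝔤)
    (hcomm : ∀ X ∈ 𝔤, ∀ a : H.endAlg, X * (a : Module.End ℚ V) = (a : Module.End ℚ V) * X)
    (hskew : ∀ X ∈ 𝔤, ∀ v w, ψ.form (X v) w + ψ.form v (X w) = 0)
    {Θ : Module.End ℂ (ℂ ⊗[ℚ] V)} (hΘ : ∀ p, ∀ x ∈ H.piece p (n - p), Θ x = ((2 * p - n : ℤ) : ℂ) • x)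
    (hΘ𝔤 : Θ ∈ spanC 𝔤) (hy𝔤 : ∀ X ∈ 𝔤, LinearMap.trace ℚ V (y * X) = 0)
    (hmixed : ∀ k, Module.finrank ℂ ↥(Module.End.eigenspace (φ.baseChange ℂ) (μ k) ⊓ H.piece 1 0) ≠ 0 ∧
      Module.finrank ℂ ↥(Module.End.eigenspace (φ.baseChange ℂ) (μ k) ⊓ H.piece 0 1) ≠ 0)
    (a b : ι) (hab : a ≠ b) (hι : ∀ k, k = a ∨ k = b)
    (hbal : ((Module.finrank ℂ ↥(Module.End.eigenspace (φ.baseChange ℂ) (μ a) ⊓ H.piece 1 0) : ℤ) -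
        Module.finrank ℂ ↥(Module.End.eigenspace (φ.baseChange ℂ) (μ a) ⊓ H.piece 0 1)) +
      ((Module.finrank ℂ ↥(Module.End.eigenspace (φ.baseChange ℂ) (μ b) ⊓ H.piece 1 0) : ℤ) -
        Module.finrank ℂ ↥(Module.End.eigenspace (φ.baseChange ℂ) (μ b) ⊓ H.piece 0 1)) = 0)
    (Z : Module.End ℂ ↥(Module.End.eigenspace (φ.baseChange ℂ) (μ a))) (hZ : LinearMap.trace ℂ _ Z = 0) :
    ∃ X ∈ spanC 𝔤, (∀ w : ↥(Module.End.eigenspace (φ.baseChange ℂ) (μ a)), X w = Z w) ∧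
      ∀ j, j ≠ a → ∀ w ∈ Module.End.eigenspace (φ.baseChange ℂ) (μ j), X w = 0 := by
  classical
  -- the blocks and the derived span
  let W : ι → Submodule ℂ (ℂ ⊗[ℚ] V) := fun k => Module.End.eigenspace (φ.baseChange ℂ) (μ k)
  set 𝔡 : Submodule ℚ (Module.End ℚ V) := Submodule.span ℚ {B | ∃ X ∈ 𝔤, ∃ X' ∈ 𝔤, X * X' - X' * X = B} with h𝔡
  have h𝔇𝔊 : spanC 𝔡 ≤ spanC 𝔤 := spanC_mono (CMDerived.derived_le hbr)
  have hXφ : ∀ X ∈ 𝔤, X.baseChange ℂ * φ.baseChange ℂ = φ.baseChange ℂ * X.baseChange ℂ := fun X hX =>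
    UnitaryTheta.baseChange_commute H hφE hcomm hX
  have hXW : ∀ X ∈ 𝔤, ∀ c, ∀ w ∈ Module.End.eigenspace (φ.baseChange ℂ) c,
      X.baseChange ℂ w ∈ Module.End.eigenspace (φ.baseChange ℂ) c := fun X hX c w hw =>
    UnitaryTheta.apply_mem_eigenspace_of_commute (hXφ X hX) hw
  have hSφ : ∀ X ∈ spanC 𝔤, X * φ.baseChange ℂ = φ.baseChange ℂ * X := fun X hX =>
    UnitaryTheta.commute_of_mem_spanC H hφE hcomm hX
  have hSW : ∀ X ∈ spanC 𝔤, ∀ c, ∀ w ∈ Module.End.eigenspace (φ.baseChange ℂ) c, X w ∈ Module.End.eigenspace (φ.baseChange ℂ) c :=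
    fun X hX c w hw => UnitaryTheta.apply_mem_eigenspace_of_commute (hSφ X hX) hw
  have hW𝔇 : ∀ X ∈ spanC 𝔡, ∀ k, ∀ w ∈ W k, X w ∈ W k := fun X hX k => hSW X (h𝔇𝔊 hX) (μ k)
  have hW𝔇' : ∀ X ∈ spanC 𝔡, ∀ k, ∀ w ∈ Module.End.eigenspace (φ.baseChange ℂ) (starRingEnd ℂ (μ k)),
      X w ∈ Module.End.eigenspace (φ.baseChange ℂ) (starRingEnd ℂ (μ k)) := fun X hX k => hSW X (h𝔇𝔊 hX) _
  have hskewS : ∀ X ∈ spanC 𝔤, ∀ x z, ψ.form.baseChange ℂ (X x) z + ψ.form.baseChange ℂ x (X z) = 0 := fun X hX x z =>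
    ThetaSubalgebra.formBaseChange_add_eq_zero_of_mem_spanC ψ hskew hX x z
  have hbr𝔇 : ∀ X ∈ spanC 𝔡, ∀ Y ∈ spanC 𝔡, X * Y - Y * X ∈ spanC 𝔡 := fun X hX Y hY =>
    commutator_mem_spanC_derived (h𝔇𝔊 hX) (h𝔇𝔊 hY)
  have htr𝔇 : ∀ X (hX : X ∈ spanC 𝔡) k, LinearMap.trace ℂ _ (X.restrict (hW𝔇 X hX k)) = 0 := fun X hX k =>
    CMDerived.trace_restrict_eq_zero (fun Y hY => hXW Y hY (μ k)) hX _
  -- irreducibility of the blocks and the projections of the derived span (eng-5 lineage)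
  have hirr := fun k => CMIrred.eigenspace_irreducible H hn heff ψ hφE hE μ hinj hdist htop 𝔤 hΘ hΘ𝔤 hcomm hskew k
  have hproj : ∀ k, ∀ Z' : Module.End ℂ ↥(W k), LinearMap.trace ℂ _ Z' = 0 → ∃ X ∈ spanC 𝔡, ∀ w : ↥(W k), X w = Z' w :=
    fun k Z' hZ' => CMNoTwist3.proj_of_mixed H hn heff hφE 𝔤 hbr hcomm hΘ hΘ𝔤 (hirr k) (hrank k) (hmixed k).1
      (hmixed k).2 Z' hZ'
  -- the adapted dual basis and the block bases extracted from it
  obtain ⟨cb, κ, hcbW, hcbW', -, -, hdual, hiso⟩ := CMTheta.exists_adaptedDualBasis H hn heff ψ hφE hE μ hinj hdist hrank htop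
  let ev : ι × Fin 2 → ℂ := fun kt => if kt.2 = 0 then μ kt.1 else starRingEnd ℂ (μ kt.1)
  have hev0 : ∀ k, ev (k, 0) = μ k := fun k => by simp [ev]
  have hev1 : ∀ k, ev (k, 1) = starRingEnd ℂ (μ k) := fun k => by simp [ev]
  have hev : Function.Injective ev := by
    rintro ⟨k, t⟩ ⟨k', t'⟩ h
    rcases CMThetaKWeil.fin2_cases_nd t with rfl | rfl <;> rcases CMThetaKWeil.fin2_cases_nd t' with rfl | rfl
    · rw [hev0, hev0] at h; rw [hinj h]
    · rw [hev0, hev1] at h; exact absurd h (hdist k' k)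
    · rw [hev1, hev0] at h; exact absurd h.symm (hdist k k')
    · rw [hev1, hev1] at h; rw [hinj ((starRingEnd ℂ).injective h)]
  have hcbev : ∀ kt ℓ, cb (kt, ℓ) ∈ Module.End.eigenspace (φ.baseChange ℂ) (ev kt) := by
    rintro ⟨k, t⟩ ℓ
    rcases CMThetaKWeil.fin2_cases_nd t with rfl | rfl
    · rw [hev0]; exact hcbW k ℓ
    · rw [hev1]; exact hcbW' k ℓ
  have hφcb : ∀ kt ℓ, φ.baseChange ℂ (cb (kt, ℓ)) = ev kt • cb (kt, ℓ) := fun kt ℓ =>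
    Module.End.mem_eigenspace_iff.1 (hcbev kt ℓ)
  have hbW : ∀ k, ∃ bWk : Module.Basis (Fin 3) ℂ ↥(W k), ∀ ℓ, (bWk ℓ : ℂ ⊗[ℚ] V) = cb ((k, 0), ℓ) := fun k =>
    exists_basis_eigenspace_of_blocks cb (f := φ.baseChange ℂ) (ε := ev) hφcb (k, 0) (μ := μ k) (hev0 k)
      (fun kt hkt h => hkt (hev (h.trans (hev0 k).symm)))
  choose bW hbW using hbW
  have hbW' : ∀ k, ∃ bWk : Module.Basis (Fin 3) ℂ ↥(Module.End.eigenspace (φ.baseChange ℂ) (starRingEnd ℂ (μ k))),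
      ∀ ℓ, (bWk ℓ : ℂ ⊗[ℚ] V) = cb ((k, 1), ℓ) := fun k =>
    exists_basis_eigenspace_of_blocks cb (f := φ.baseChange ℂ) (ε := ev) hφcb (k, 1) (μ := starRingEnd ℂ (μ k)) (hev1 k)
      (fun kt hkt h => hkt (hev (h.trans (hev1 k).symm)))
  choose bW' hbW' using hbW'
  -- Goursat–Kolchin–Ribet at the place `a`
  rcases Literature.Algebra.Lie.LieGoursatTwist.lift_or_twist_of_submodules (k := ℂ) W (d := 3) (by norm_num) bW (spanC 𝔡) hbr𝔇
      hW𝔇 htr𝔇 hproj a with hlift | ⟨j, hj, e, A, hA, htw⟩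
  · obtain ⟨X, hX, h1, h2⟩ := hlift Z hZ
    exact ⟨X, h𝔇𝔊 hX, h1, h2⟩
  exfalso
  obtain rfl : j = b := (hι j).resolve_left hj
  rcases htw with hI | ⟨-, hII⟩
  · -- TWIST I: an intertwiner `W_{μ j} ≃ W_{μ a}` — equal signatures, contradicting the balance for `n₀ = 3`
    obtain ⟨T, hT⟩ := CMThetaKWeil.exists_equiv_of_matrix_twist (bW a) (bW j) (spanC 𝔡) (fun X hX => hW𝔇 X hX a)
      (fun X hX => hW𝔇 X hX j) e hA hI
    have hsig := CMThetaKWeil.finrank_sub_eq_of_intertwiner H hn heff hφE 𝔤 hbr hcomm hΘ hΘ𝔤 (a := μ j) (b := μ a)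
      (hmixed j).1 (hmixed j).2 (hproj a) T hT
    have hsigZ : ((Module.finrank ℂ ↥(Module.End.eigenspace (φ.baseChange ℂ) (μ a) ⊓ H.piece 1 0) : ℤ) -
        Module.finrank ℂ ↥(Module.End.eigenspace (φ.baseChange ℂ) (μ a) ⊓ H.piece 0 1)) =
      ((Module.finrank ℂ ↥(Module.End.eigenspace (φ.baseChange ℂ) (μ j) ⊓ H.piece 1 0) : ℤ) -
        Module.finrank ℂ ↥(Module.End.eigenspace (φ.baseChange ℂ) (μ j) ⊓ H.piece 0 1)) := by
      exact_mod_cast hsig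
    have h3 := hrank a
    omega
  · -- TWIST II: transposed through the dual basis, an intertwiner `W_{μ̄ j} ≃ W_{μ a}` — dead by R11-4
    have hII' : ∀ X (hX : X ∈ spanC 𝔡), LinearMap.toMatrix (bW a) (bW a) (X.restrict (hW𝔇 X hX a)) =
        A⁻¹ * (LinearMap.toMatrix (bW' j) (bW' j) (X.restrict (hW𝔇' X hX j))).submatrix e.symm e.symm * A := by
      intro X hX
      have hM := CMThetaKWeil.toMatrix_restrict_conj_eq_neg_transpose cb (ψ.form.baseChange ℂ) hdual hiso (bW j) (bW' j) j
        (hbW j) (hbW' j) (hW𝔇 X hX j) (hW𝔇' X hX j) (hskewS X (h𝔇𝔊 hX))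
      rw [hII X hX, hM]
      have hneg : (-(LinearMap.toMatrix (bW j) (bW j) (X.restrict (hW𝔇 X hX j)))ᵀ).submatrix e.symm e.symm =
          -((LinearMap.toMatrix (bW j) (bW j) (X.restrict (hW𝔇 X hX j))).submatrix e.symm e.symm)ᵀ := by
        ext i i'
        simp [Matrix.submatrix_apply, Matrix.transpose_apply]
      rw [hneg, Matrix.mul_neg, Matrix.neg_mul]
    obtain ⟨T, hT⟩ := CMThetaKWeil.exists_equiv_of_matrix_twist (bW a) (bW' j) (spanC 𝔡) (fun X hX => hW𝔇 X hX a)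
      (fun X hX => hW𝔇' X hX j) e hA hII'
    exact CMThetaKWeil.not_exists_intertwiner_conj_of_traceOrthogonal H hn heff ψ hφE hE μ hinj hdist (n₀ := 3) (by norm_num)
      hrank htop hyskew hν hyν a j hab hι 𝔤 hbr hcomm hskew hΘ hΘ𝔤 hy𝔤 (hproj a) ⟨T, hT⟩

/-- **THE LIFT PROPERTY FOR TWO MIXED PLACES OF A `K`-WEIL CM TYPE — DIVISION-FREE** (at every place; see
`CMThetaKWeil.lift_at_of_twoMixed_kWeil`) — the input `hlift` of the cell's sockets `CMThetaSocket.*` for TABLE X row 11.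
[cite: MoonenZarhin1999LowDim, §2 (2.3)] [cite: Ribet1983, §3 and Thm. 0] [cite: MoonenZarhin1998WeilClasses, §4 Remark (1)] -/
theorem CMThetaKWeil.lift_of_twoMixed_kWeil_noDiv [Module.Finite ℚ V] [HodgeTensorFacts.{u, u}] {ι : Type} [Fintype ι]
    [DecidableEq ι] (H : HodgeStructure V n) (hn : n = 1) (heff : H.IsEffective) (ψ : H.Polarization)
    {φ : Module.End ℚ V} (hφE : φ ∈ H.endAlg) {m : ℕ} (hE : ∀ a ∈ H.endAlg, ∃ q : Fin m → ℚ, a = ∑ k, q k • φ ^ (k : ℕ))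
    (μ : ι → ℂ) (hinj : Function.Injective μ) (hdist : ∀ k k', μ k' ≠ starRingEnd ℂ (μ k))
    (hrank : ∀ k, Module.finrank ℂ ↥(Module.End.eigenspace (φ.baseChange ℂ) (μ k) ⊓ H.piece 1 0) +
      Module.finrank ℂ ↥(Module.End.eigenspace (φ.baseChange ℂ) (μ k) ⊓ H.piece 0 1) = 3)
    (htop : (⨆ kt : ι × Fin 2, Module.End.eigenspace (φ.baseChange ℂ)
      (if kt.2 = 0 then μ kt.1 else starRingEnd ℂ (μ kt.1))) = ⊤)
    {y : Module.End ℚ V} (hyskew : ∀ v w, ψ.form (y v) w + ψ.form v (y w) = 0) {ν : ℂ} (hν : ν ≠ 0)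
    (hyν : ∀ k, ∀ w ∈ Module.End.eigenspace (φ.baseChange ℂ) (μ k), y.baseChange ℂ w = ν • w)
    (𝔤 : Submodule ℚ (Module.End ℚ V)) (hbr : ∀ X ∈ 𝔤, ∀ X' ∈ 𝔤, X * X' - X' * X ∈ 𝔤)
    (hcomm : ∀ X ∈ 𝔤, ∀ a : H.endAlg, X * (a : Module.End ℚ V) = (a : Module.End ℚ V) * X)
    (hskew : ∀ X ∈ 𝔤, ∀ v w, ψ.form (X v) w + ψ.form v (X w) = 0)
    {Θ : Module.End ℂ (ℂ ⊗[ℚ] V)} (hΘ : ∀ p, ∀ x ∈ H.piece p (n - p), Θ x = ((2 * p - n : ℤ) : ℂ) • x)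
    (hΘ𝔤 : Θ ∈ spanC 𝔤) (hy𝔤 : ∀ X ∈ 𝔤, LinearMap.trace ℚ V (y * X) = 0)
    (hmixed : ∀ k, Module.finrank ℂ ↥(Module.End.eigenspace (φ.baseChange ℂ) (μ k) ⊓ H.piece 1 0) ≠ 0 ∧
      Module.finrank ℂ ↥(Module.End.eigenspace (φ.baseChange ℂ) (μ k) ⊓ H.piece 0 1) ≠ 0)
    (k₁ k₂ : ι) (hk : k₁ ≠ k₂) (hι : ∀ k, k = k₁ ∨ k = k₂)
    (hbal : ((Module.finrank ℂ ↥(Module.End.eigenspace (φ.baseChange ℂ) (μ k₁) ⊓ H.piece 1 0) : ℤ) -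
        Module.finrank ℂ ↥(Module.End.eigenspace (φ.baseChange ℂ) (μ k₁) ⊓ H.piece 0 1)) +
      ((Module.finrank ℂ ↥(Module.End.eigenspace (φ.baseChange ℂ) (μ k₂) ⊓ H.piece 1 0) : ℤ) -
        Module.finrank ℂ ↥(Module.End.eigenspace (φ.baseChange ℂ) (μ k₂) ⊓ H.piece 0 1)) = 0)
    (k : ι) (Z : Module.End ℂ ↥(Module.End.eigenspace (φ.baseChange ℂ) (μ k))) (hZ : LinearMap.trace ℂ _ Z = 0) :
    ∃ X ∈ spanC 𝔤, (∀ w : ↥(Module.End.eigenspace (φ.baseChange ℂ) (μ k)), X w = Z w) ∧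
      ∀ j, j ≠ k → ∀ w ∈ Module.End.eigenspace (φ.baseChange ℂ) (μ j), X w = 0 := by
  rcases hι k with rfl | rfl
  · exact CMThetaKWeil.lift_at_of_twoMixed_kWeil_noDiv H hn heff ψ hφE hE μ hinj hdist hrank htop hyskew hν hyν 𝔤 hbr hcomm
      hskew hΘ hΘ𝔤 hy𝔤 hmixed k k₂ hk hι hbal Z hZ
  · exact CMThetaKWeil.lift_at_of_twoMixed_kWeil_noDiv H hn heff ψ hφE hE μ hinj hdist hrank htop hyskew hν hyν 𝔤 hbr hcomm
      hskew hΘ hΘ𝔤 hy𝔤 hmixed k k₁ hk.symm (fun j => (hι j).symm) (by rw [add_comm]; exact hbal) Z hZ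

/-! ### §5 The socket: `𝔤_ℂ ⊇ (𝔲_E ∩ 𝔰𝔲_K)_ℂ` -/

/-- **`𝔤_ℂ ⊇ (𝔲_E ∩ 𝔰𝔲_K)_ℂ` FOR TWO MIXED PLACES OF A `K`-WEIL CM TYPE — DIVISION-FREE** (`E = ℚ[φ]` a CM field or `K × K`) (admissible `𝔤 ∋ Θ_ℂ` trace-orthogonal to the
`K`-datum `y`; see the module docstring): every `φ_ℂ`-commuting `ψ_ℂ`-skew operator `Y` with `tr(Y|_{W_{μk₁}}) + tr(Y|_{W_{μk₂}}) = 0`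
lies in `𝔤_ℂ` — the LIFT property §4 fed into the socket `CMThetaSocket.mem_spanC_of_lift_of_trace_add_eq_zero`.
[cite: MoonenZarhin1998WeilClasses, §4 Remark (1)] [cite: MoonenZarhin1999LowDim, §2 (2.3)] [cite: Ribet1983, Thm. 0]
[cite: Deligne1982HodgeCycles, I §3 Prop. 3.4 and §4] -/
theorem CMThetaKWeil.mem_spanC_of_commute_of_skew_of_trace_twoMixed_noDiv [Module.Finite ℚ V] [HodgeTensorFacts.{u, u}] {ι : Type}
    [Fintype ι] [DecidableEq ι] (H : HodgeStructure V n) (hn : n = 1) (heff : H.IsEffective) (ψ : H.Polarization)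
    {φ : Module.End ℚ V} (hφE : φ ∈ H.endAlg) {m : ℕ} (hE : ∀ a ∈ H.endAlg, ∃ q : Fin m → ℚ, a = ∑ k, q k • φ ^ (k : ℕ))
    (μ : ι → ℂ) (hinj : Function.Injective μ) (hdist : ∀ k k', μ k' ≠ starRingEnd ℂ (μ k))
    (hrank : ∀ k, Module.finrank ℂ ↥(Module.End.eigenspace (φ.baseChange ℂ) (μ k) ⊓ H.piece 1 0) +
      Module.finrank ℂ ↥(Module.End.eigenspace (φ.baseChange ℂ) (μ k) ⊓ H.piece 0 1) = 3)
    (htop : (⨆ kt : ι × Fin 2, Module.End.eigenspace (φ.baseChange ℂ)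
      (if kt.2 = 0 then μ kt.1 else starRingEnd ℂ (μ kt.1))) = ⊤)
    {y : Module.End ℚ V} (hyskew : ∀ v w, ψ.form (y v) w + ψ.form v (y w) = 0) {ν : ℂ} (hν : ν ≠ 0)
    (hyν : ∀ k, ∀ w ∈ Module.End.eigenspace (φ.baseChange ℂ) (μ k), y.baseChange ℂ w = ν • w)
    (𝔤 : Submodule ℚ (Module.End ℚ V)) (hbr : ∀ X ∈ 𝔤, ∀ X' ∈ 𝔤, X * X' - X' * X ∈ 𝔤)
    (hcomm : ∀ X ∈ 𝔤, ∀ a : H.endAlg, X * (a : Module.End ℚ V) = (a : Module.End ℚ V) * X)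
    (hskew : ∀ X ∈ 𝔤, ∀ v w, ψ.form (X v) w + ψ.form v (X w) = 0)
    {Θ : Module.End ℂ (ℂ ⊗[ℚ] V)} (hΘ : ∀ p, ∀ x ∈ H.piece p (n - p), Θ x = ((2 * p - n : ℤ) : ℂ) • x)
    (hΘ𝔤 : Θ ∈ spanC 𝔤) (hy𝔤 : ∀ X ∈ 𝔤, LinearMap.trace ℚ V (y * X) = 0)
    (hmixed : ∀ k, Module.finrank ℂ ↥(Module.End.eigenspace (φ.baseChange ℂ) (μ k) ⊓ H.piece 1 0) ≠ 0 ∧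
      Module.finrank ℂ ↥(Module.End.eigenspace (φ.baseChange ℂ) (μ k) ⊓ H.piece 0 1) ≠ 0)
    (k₁ k₂ : ι) (hk : k₁ ≠ k₂) (hι : ∀ k, k = k₁ ∨ k = k₂)
    (hbal : ((Module.finrank ℂ ↥(Module.End.eigenspace (φ.baseChange ℂ) (μ k₁) ⊓ H.piece 1 0) : ℤ) -
        Module.finrank ℂ ↥(Module.End.eigenspace (φ.baseChange ℂ) (μ k₁) ⊓ H.piece 0 1)) +
      ((Module.finrank ℂ ↥(Module.End.eigenspace (φ.baseChange ℂ) (μ k₂) ⊓ H.piece 1 0) : ℤ) -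
        Module.finrank ℂ ↥(Module.End.eigenspace (φ.baseChange ℂ) (μ k₂) ⊓ H.piece 0 1)) = 0)
    {Y : Module.End ℂ (ℂ ⊗[ℚ] V)} (hYφ : Y * φ.baseChange ℂ = φ.baseChange ℂ * Y)
    (hYskew : ∀ x z, ψ.form.baseChange ℂ (Y x) z + ψ.form.baseChange ℂ x (Y z) = 0)
    (hYtr : LinearMap.trace ℂ _ (Y.restrict fun x (hx : x ∈ Module.End.eigenspace (φ.baseChange ℂ) (μ k₁)) =>
        UnitaryTheta.apply_mem_eigenspace_of_commute hYφ hx) +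
      LinearMap.trace ℂ _ (Y.restrict fun x (hx : x ∈ Module.End.eigenspace (φ.baseChange ℂ) (μ k₂)) =>
        UnitaryTheta.apply_mem_eigenspace_of_commute hYφ hx) = 0) :
    Y ∈ spanC 𝔤 := by
  have ht₁ : Module.finrank ℂ ↥(Module.End.eigenspace (φ.baseChange ℂ) (μ k₁) ⊓ H.piece 1 0) ≠
      Module.finrank ℂ ↥(Module.End.eigenspace (φ.baseChange ℂ) (μ k₁) ⊓ H.piece 0 1) := by
    have h := hrank k₁; omega
  exact CMThetaSocket.mem_spanC_of_lift_of_trace_add_eq_zero H hn heff ψ hφE hE (n₀ := 3) (by norm_num) μ hinj hdist hrank htop 𝔤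
    hcomm hskew hΘ hΘ𝔤 (CMThetaKWeil.lift_of_twoMixed_kWeil_noDiv H hn heff ψ hφE hE μ hinj hdist hrank htop hyskew hν hyν 𝔤
      hbr hcomm hskew hΘ hΘ𝔤 hy𝔤 hmixed k₁ k₂ hk hι hbal) k₁ k₂ hk hι hbal ht₁ hYφ hYskew hYtr

/-- **`Lie Hg ⊗ ℂ ⊇ (𝔲_E ∩ 𝔰𝔲_K) ⊗ ℂ` FOR TWO MIXED PLACES OF A `K`-WEIL CM TYPE — UNCONDITIONAL, DIVISION-FREE** (`𝔤 = Lie Hg(H)`; the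
trace-orthogonality to `y` is `CMThetaKWeil.trace_mul_eq_zero_of_mem_hodgeLie`): `H` effective polarized of weight `1`,
`E = End_Hdg(V) = ℚ[φ]` single-generated (NO division hypothesis: a CM field or `K × K`), CM type `μ` with `ι = {k₁, k₂}` and
`3`-dimensional blocks both mixed, `y ∈ E` `ψ`-skew acting by one scalar `ν ≠ 0` on the CM type, balance
`(p₁ − q₁) + (p₂ − q₂) = 0`. Then every `φ_ℂ`-commuting `ψ_ℂ`-skew `Y` with `tr(Y|_{W_{μk₁}}) + tr(Y|_{W_{μk₂}}) = 0` lies in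
`Lie Hg(H) ⊗ ℂ`. (The biquadratic `(2,1)+(1,2)` members of TABLE X row 11 AND the products `Y₃ × Y₃′` of row 19, at the level of Hodge structures.)
[cite: MoonenZarhin1998WeilClasses, §4 Remark (1)] [cite: MoonenZarhin1999LowDim, §2 (2.3) and §3 (3.1)] [cite: Ribet1983, Thm. 0] -/
theorem CMThetaKWeil.mem_hodgeLieC_of_commute_of_skew_of_trace_twoMixed_noDiv [Module.Finite ℚ V] [HodgeTensorFacts.{u, u}] {ι : Type}
    [Fintype ι] [DecidableEq ι] (H : HodgeStructure V n) (hn : n = 1) (heff : H.IsEffective) (ψ : H.Polarization)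
    {φ : Module.End ℚ V} (hφE : φ ∈ H.endAlg) {m : ℕ} (hE : ∀ a ∈ H.endAlg, ∃ q : Fin m → ℚ, a = ∑ k, q k • φ ^ (k : ℕ))
    (μ : ι → ℂ) (hinj : Function.Injective μ) (hdist : ∀ k k', μ k' ≠ starRingEnd ℂ (μ k))
    (hrank : ∀ k, Module.finrank ℂ ↥(Module.End.eigenspace (φ.baseChange ℂ) (μ k) ⊓ H.piece 1 0) +
      Module.finrank ℂ ↥(Module.End.eigenspace (φ.baseChange ℂ) (μ k) ⊓ H.piece 0 1) = 3)
    (htop : (⨆ kt : ι × Fin 2, Module.End.eigenspace (φ.baseChange ℂ)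
      (if kt.2 = 0 then μ kt.1 else starRingEnd ℂ (μ kt.1))) = ⊤)
    {y : Module.End ℚ V} (hyE : y ∈ H.endAlg) (hyskew : ∀ v w, ψ.form (y v) w + ψ.form v (y w) = 0) {ν : ℂ} (hν : ν ≠ 0)
    (hyν : ∀ k, ∀ w ∈ Module.End.eigenspace (φ.baseChange ℂ) (μ k), y.baseChange ℂ w = ν • w)
    (hmixed : ∀ k, Module.finrank ℂ ↥(Module.End.eigenspace (φ.baseChange ℂ) (μ k) ⊓ H.piece 1 0) ≠ 0 ∧
      Module.finrank ℂ ↥(Module.End.eigenspace (φ.baseChange ℂ) (μ k) ⊓ H.piece 0 1) ≠ 0)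
    (k₁ k₂ : ι) (hk : k₁ ≠ k₂) (hι : ∀ k, k = k₁ ∨ k = k₂)
    (hbal : ((Module.finrank ℂ ↥(Module.End.eigenspace (φ.baseChange ℂ) (μ k₁) ⊓ H.piece 1 0) : ℤ) -
        Module.finrank ℂ ↥(Module.End.eigenspace (φ.baseChange ℂ) (μ k₁) ⊓ H.piece 0 1)) +
      ((Module.finrank ℂ ↥(Module.End.eigenspace (φ.baseChange ℂ) (μ k₂) ⊓ H.piece 1 0) : ℤ) -
        Module.finrank ℂ ↥(Module.End.eigenspace (φ.baseChange ℂ) (μ k₂) ⊓ H.piece 0 1)) = 0)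
    {Y : Module.End ℂ (ℂ ⊗[ℚ] V)} (hYφ : Y * φ.baseChange ℂ = φ.baseChange ℂ * Y)
    (hYskew : ∀ x z, ψ.form.baseChange ℂ (Y x) z + ψ.form.baseChange ℂ x (Y z) = 0)
    (hYtr : LinearMap.trace ℂ _ (Y.restrict fun x (hx : x ∈ Module.End.eigenspace (φ.baseChange ℂ) (μ k₁)) =>
        UnitaryTheta.apply_mem_eigenspace_of_commute hYφ hx) +
      LinearMap.trace ℂ _ (Y.restrict fun x (hx : x ∈ Module.End.eigenspace (φ.baseChange ℂ) (μ k₂)) =>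
        UnitaryTheta.apply_mem_eigenspace_of_commute hYφ hx) = 0) :
    Y ∈ H.hodgeLieC := by
  classical
  have hbalC : ∑ k, ν * (((Module.finrank ℂ ↥(Module.End.eigenspace (φ.baseChange ℂ) (μ k) ⊓ H.piece 1 0)) : ℂ) -
      (Module.finrank ℂ ↥(Module.End.eigenspace (φ.baseChange ℂ) (μ k) ⊓ H.piece 0 1) : ℂ)) = 0 := by
    have huniv : (Finset.univ : Finset ι) = {k₁, k₂} := by
      ext k
      simp only [Finset.mem_univ, Finset.mem_insert, Finset.mem_singleton, true_iff]
      exact hι k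
    rw [huniv, Finset.sum_insert (by rw [Finset.mem_singleton]; exact hk), Finset.sum_singleton, ← mul_add]
    have h := congrArg (fun z : ℤ => (z : ℂ)) hbal
    simp only [Int.cast_add, Int.cast_sub, Int.cast_natCast, Int.cast_zero] at h
    rw [h, mul_zero]
  have hy𝔤 := CMThetaKWeil.trace_mul_eq_zero_of_mem_hodgeLie H hn heff ψ hφE hE μ hinj hdist hrank htop hyE hyskew (fun _ => ν)
    hyν hbalC
  obtain ⟨Θ, hΘ⟩ := exists_hodgeTheta H
  have hΘ𝔤 : Θ ∈ spanC H.hodgeLie := (hodgeLieC_eq_spanC H) ▸ H.mem_hodgeLieC_of_forall_piece hΘ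
  rw [hodgeLieC_eq_spanC]
  exact CMThetaKWeil.mem_spanC_of_commute_of_skew_of_trace_twoMixed_noDiv H hn heff ψ hφE hE μ hinj hdist hrank htop hyskew
    hν hyν H.hodgeLie (fun X hX X' hX' => H.commutator_mem_hodgeLie hX hX') (fun X hX a => H.commute_of_mem_hodgeLie hX a)
    (fun X hX => form_apply_add_eq_zero_of_mem_hodgeLie ψ hX) hΘ hΘ𝔤 hy𝔤 hmixed k₁ k₂ hk hι hbal hYφ hYskew hYtr

end HodgeStructure

end Literature.AlgebraicGeometry.Motives

end
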